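import Summits.MatrixMultiplication.OmegaCensus.DominoNormCharacters
import Mathlib.Algebra.BigOperators.Ring.Finset
import HarnessLib

/-!
# The unit equation of a domino cube law triple at a non-trivial character

ω-census `pub-omega`, family (b3), seat pub-omega-group gen 30.  Framing: lottery ticket; floor = certified bounds/negative
ranges.  VALUE: step 1 of the NORM CONGRUENCE `|B| ∣ (3d²)^{p−1} − 1` (`DominoNormCongruence.lean`); NOT progress on ω.

Data: a finite abelian group `B`, count functions `F, G : B → ℕ`, shifts `b₁ b₂ : B`, a point `s` and a constant `K` with the
shifted line identity of `DominoShiftedForm.radon_identity_shifted`,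
`Σ_u (F(t−u) + F(u−(t−b₁)) + F((t−b₂)+u))·G(u) + [s = t] = K` for every `t : B`.
* `char_identity`: at every non-trivial character `χ`, with `a = Σ F(v)χ(v)`, `ā = Σ F(v)χ(−v)`, `b, b̄` likewise,
  `β = χ(b₁)`, `γ = χ(b₂)`:  `ab + β ā b + γ a b̄ = −χ(s)`.
* `Dsh_mul_Dsh`: the polynomial identity `D_β(a) D_γ(b) = u² − βγ u ū + β²γ² ū²` for the twisted discriminant
  `D_β(a) = a² + β a ā + β² ā²`, `u = ab + βāb + γab̄`, `ū = āb̄ + β⁻¹ab̄ + γ⁻¹āb`.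
* `Dval_mul_Dval`: hence **`D(F,χ) · D(G,χ) = χ(s)² − χ(b₁)χ(b₂) + χ(b₁)²χ(b₂)²χ(−s)²`** — a unit of `ℤ[ζ_p]` when `B` has
  exponent `p ≥ 5` (the "unit test" of `DominoLineUnitObstruction.lean`, here for all characters of `B` at once and with shifts).
-/

namespace Summit.MatrixMultiplication.OmegaCensus.DominoNorm

open Finset

section Main

variable {B : Type*} [AddCommGroup B] [Fintype B] [DecidableEq B]

/-! ## Character sums of count functions and the twisted discriminant -/

/-- Character sum `Σ_v F(v) χ(v)` of a count function. [folklore] -/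
noncomputable def chs (F : B → ℕ) (χ : AddChar B ℂ) : ℂ := ∑ v, (F v : ℂ) * χ v

omit [DecidableEq B] in
/-- At the trivial character the character sum is the total mass. [folklore] -/
theorem chs_one (F : B → ℕ) : chs F 1 = ((∑ v, F v : ℕ) : ℂ) := by
  unfold chs; push_cast; simp

omit [DecidableEq B] in
/-- Complex conjugation inverts the character. [folklore] -/
theorem conj_chs (F : B → ℕ) (χ : AddChar B ℂ) : starRingEnd ℂ (chs F χ) = chs F χ⁻¹ := by
  unfold chs
  rw [map_sum]
  exact sum_congr rfl fun v _ => by rw [map_mul, map_natCast, conj_addChar_apply]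

/-- The twisted discriminant `D_β(a) = a² + β a ā + β² ā²`. [folklore] -/
def Dsh (β a a' : ℂ) : ℂ := a ^ 2 + β * a * a' + β ^ 2 * a' ^ 2

/-- **The polynomial identity** `D_β(a) D_γ(b) = u² − βγ u ū + β²γ² ū²` for `u = ab + βāb + γab̄`,
`ū = āb̄ + β⁻¹ab̄ + γ⁻¹āb`. [folklore] -/
theorem Dsh_mul_Dsh {β β' γ γ' a a' b b' : ℂ} (hβ : β * β' = 1) (hγ : γ * γ' = 1) :
    Dsh β a a' * Dsh γ b b' =
      (a * b + β * a' * b + γ * a * b') ^ 2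
        - β * γ * (a * b + β * a' * b + γ * a * b') * (a' * b' + β' * a * b' + γ' * a' * b)
        + β ^ 2 * γ ^ 2 * (a' * b' + β' * a * b' + γ' * a' * b) ^ 2 := by
  have hβ0 : β ≠ 0 := left_ne_zero_of_mul_eq_one hβ
  have hγ0 : γ ≠ 0 := left_ne_zero_of_mul_eq_one hγ
  have eβ : β' = β⁻¹ := eq_inv_of_mul_eq_one_right hβ
  have eγ : γ' = γ⁻¹ := eq_inv_of_mul_eq_one_right hγ
  subst eβ eγ
  unfold Dsh
  field_simp
  ring

/-- The `D`-value of `F` at `χ` with shift `b₁`: `D_{χ b₁}(χ(F))`. [folklore] -/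
noncomputable def Dval (F : B → ℕ) (b₁ : B) (χ : AddChar B ℂ) : ℂ := Dsh (χ b₁) (chs F χ) (chs F χ⁻¹)

omit [DecidableEq B] in
/-- `D`-value at the trivial character: `3 (Σ F)²`. [folklore] -/
theorem Dval_one (F : B → ℕ) (b₁ : B) : Dval F b₁ 1 = 3 * ((∑ v, F v : ℕ) : ℂ) ^ 2 := by
  unfold Dval Dsh
  rw [inv_one, chs_one, AddChar.one_apply]
  ring

omit [DecidableEq B] in
/-- Conjugation: `conj D(χ) = D(χ⁻¹)`. [folklore] -/
theorem conj_Dval (F : B → ℕ) (b₁ : B) (χ : AddChar B ℂ) :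
    starRingEnd ℂ (Dval F b₁ χ) = Dval F b₁ χ⁻¹ := by
  unfold Dval Dsh
  simp only [map_add, map_mul, map_pow, conj_chs, conj_addChar_apply, inv_inv]

/-! ## The identity at a non-trivial character -/

omit [DecidableEq B] in
/-- `Σ_t F(t − u) χ(t) = χ(u) χ(F)`. [folklore] -/
theorem sum_shift₁ (F : B → ℕ) (χ : AddChar B ℂ) (u : B) :
    ∑ t, (F (t - u) : ℂ) * χ t = χ u * chs F χ := by
  rw [← Equiv.sum_comp (Equiv.addRight u), chs, mul_sum]
  refine sum_congr rfl fun w _ => ?_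
  simp only [Equiv.coe_addRight]
  rw [add_sub_cancel_right, AddChar.map_add_eq_mul]
  ring

omit [DecidableEq B] in
/-- `Σ_t F(u − (t − b₁)) χ(t) = χ(u) χ(b₁) χ⁻¹(F)`. [folklore] -/
theorem sum_shift₂ (F : B → ℕ) (χ : AddChar B ℂ) (u b₁ : B) :
    ∑ t, (F (u - (t - b₁)) : ℂ) * χ t = χ u * χ b₁ * chs F χ⁻¹ := by
  rw [← Equiv.sum_comp (Equiv.subLeft (u + b₁)), chs, mul_sum]
  refine sum_congr rfl fun w _ => ?_
  rw [Equiv.subLeft_apply, show u - (u + b₁ - w - b₁) = w by abel, show u + b₁ - w = u + b₁ + -w by abel,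
    AddChar.map_add_eq_mul, AddChar.map_add_eq_mul, AddChar.inv_apply]
  ring

omit [DecidableEq B] in
/-- `Σ_t F((t − b₂) + u) χ(t) = χ(b₂) χ⁻¹(u) χ(F)`. [folklore] -/
theorem sum_shift₃ (F : B → ℕ) (χ : AddChar B ℂ) (u b₂ : B) :
    ∑ t, (F ((t - b₂) + u) : ℂ) * χ t = χ b₂ * χ⁻¹ u * chs F χ := by
  rw [← Equiv.sum_comp (Equiv.addRight (b₂ - u)), chs, mul_sum]
  refine sum_congr rfl fun w _ => ?_
  simp only [Equiv.coe_addRight]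
  rw [show w + (b₂ - u) - b₂ + u = w by abel, show w + (b₂ - u) = w + b₂ + -u by abel,
    AddChar.map_add_eq_mul, AddChar.map_add_eq_mul, AddChar.inv_apply]
  ring

/-- **Character form of the shifted line identity**: `ab + β ā b + γ a b̄ = −χ(s)` at every `χ ≠ 0`. [folklore] -/
theorem char_identity (F G : B → ℕ) (b₁ b₂ s : B) (K : ℕ)
    (hID : ∀ t : B, (∑ u, (F (t - u) + F (u - (t - b₁)) + F ((t - b₂) + u)) * G u) +
      (if s = t then 1 else 0) = K)
    {χ : AddChar B ℂ} (hχ : χ ≠ 0) :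
    chs F χ * chs G χ + χ b₁ * chs F χ⁻¹ * chs G χ + χ b₂ * chs F χ * chs G χ⁻¹ = -χ s := by
  -- sum `χ t ·` (identity at `t`) over `t`
  have hsum : ∑ t, (((∑ u, (F (t - u) + F (u - (t - b₁)) + F ((t - b₂) + u)) * G u) +
      (if s = t then 1 else 0) : ℕ) : ℂ) * χ t = ∑ t, (K : ℂ) * χ t :=
    sum_congr rfl fun t _ => by rw [hID t]
  rw [← mul_sum, AddChar.sum_eq_zero_iff_ne_zero.2 hχ, mul_zero] at hsum
  -- expand the left-hand side
  have hL : ∀ t, (((∑ u, (F (t - u) + F (u - (t - b₁)) + F ((t - b₂) + u)) * G u) +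
      (if s = t then 1 else 0) : ℕ) : ℂ) * χ t =
      (∑ u, (G u : ℂ) * ((F (t - u) : ℂ) * χ t)) + (∑ u, (G u : ℂ) * ((F (u - (t - b₁)) : ℂ) * χ t)) +
        (∑ u, (G u : ℂ) * ((F ((t - b₂) + u) : ℂ) * χ t)) + (if s = t then 1 else 0) * χ t := by
    intro t
    push_cast
    rw [add_mul, sum_mul, ← sum_add_distrib, ← sum_add_distrib]
    congr 1
    exact sum_congr rfl fun u _ => by ring
  simp_rw [hL, sum_add_distrib] at hsum
  rw [sum_comm (f := fun t u => (G u : ℂ) * ((F (t - u) : ℂ) * χ t)),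
    sum_comm (f := fun t u => (G u : ℂ) * ((F (u - (t - b₁)) : ℂ) * χ t)),
    sum_comm (f := fun t u => (G u : ℂ) * ((F ((t - b₂) + u) : ℂ) * χ t))] at hsum
  simp_rw [← mul_sum, sum_shift₁, sum_shift₂, sum_shift₃, ite_mul, one_mul, zero_mul, Finset.sum_ite_eq,
    mem_univ, if_true] at hsum
  -- collect
  have e1 : ∑ u, (G u : ℂ) * (χ u * chs F χ) = chs F χ * chs G χ := by
    rw [chs, chs, mul_sum]; exact sum_congr rfl fun u _ => by ring
  have e2 : ∑ u, (G u : ℂ) * (χ u * χ b₁ * chs F χ⁻¹) = χ b₁ * chs F χ⁻¹ * chs G χ := by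
    rw [chs, chs, mul_sum]; exact sum_congr rfl fun u _ => by ring
  have e3 : ∑ u, (G u : ℂ) * (χ b₂ * χ⁻¹ u * chs F χ) = χ b₂ * chs F χ * chs G χ⁻¹ := by
    rw [chs, chs, mul_sum]; exact sum_congr rfl fun u _ => by ring
  rw [e1, e2, e3] at hsum
  linear_combination hsum

/-- **The unit equation**: `D(F,χ) · D(G,χ) = χ(s)² − χ(b₁)χ(b₂) + χ(b₁)²χ(b₂)²χ⁻¹(s)²` at `χ ≠ 0`. [folklore] -/
theorem Dval_mul_Dval (F G : B → ℕ) (b₁ b₂ s : B) (K : ℕ)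
    (hID : ∀ t : B, (∑ u, (F (t - u) + F (u - (t - b₁)) + F ((t - b₂) + u)) * G u) +
      (if s = t then 1 else 0) = K)
    {χ : AddChar B ℂ} (hχ : χ ≠ 0) :
    Dval F b₁ χ * Dval G b₂ χ = χ s ^ 2 - χ b₁ * χ b₂ + χ b₁ ^ 2 * χ b₂ ^ 2 * χ⁻¹ s ^ 2 := by
  have h1 := char_identity F G b₁ b₂ s K hID hχ
  have hχ' : χ⁻¹ ≠ 0 := inv_ne_one.2 hχ
  have h2 := char_identity F G b₁ b₂ s K hID hχ'
  rw [inv_inv] at h2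
  have hu : ∀ b : B, χ b * χ⁻¹ b = 1 := fun b => by
    rw [AddChar.inv_apply, ← AddChar.map_add_eq_mul, add_neg_cancel, AddChar.map_zero_eq_one]
  unfold Dval
  rw [Dsh_mul_Dsh (hu b₁) (hu b₂), h1, h2]
  linear_combination (-(χ b₁ * χ b₂)) * hu s

end Main

end Summit.MatrixMultiplication.OmegaCensus.DominoNorm
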